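import Summits.BirchSwinnertonDyer.BirchSwinnertonDyer.Theorems.EisensteinPrimesGoodLatticeBDPValueFullDescentStub
import Literature.NumberTheory.EllipticCurves.KellerYin2024.AnomalousLambdaInvariants
import HarnessLib

/-!
# Crux 2 `GoodLatticeBDPValue` (stmt-BirchSwinnertonDyer-19032): the preprint claim KY Thm. 2.2.2 at EVERY odd `p`
# (`thm222_anacong_goodLattice_OPEN`) FOLLOWS from the two composed-print statements and the kernel theorem T′

LEAD bsd-line-x1-p1 (gen 5), cell `bsd-eis`; `--supports -19032`, helper. BOOKKEEPING THEOREM (pure logic + one tree theorem):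
`thm222_OPEN_of_fullDescentDatum_of_five_le (hFD) (h5) : KellerYin2024.thm222_anacong_goodLattice_OPEN`, where
`h5 = KellerYin2024.thm222_anacong_goodLattice_of_five_le` (ACCEPTED composed-print named fact, `5 ≤ p`) and `hFD` is the statement
of the registered stub 3a-A `stub_anacongOfFullDescentDatum` of halves v22 (= the Literature CANDIDATE
`KellerYin2024.thm222_anacong_goodLattice_of_fullDescentDatum`, `Cruxes/GoodLatticeBDPValue/Lines/halves_3aA_literature_candidate.lean`,
referee C3 pending): an odd prime is `3` or `≥ 5`; at `p = 3` the full-descent datum demanded by `hFD` is supplied by the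
UNCONDITIONAL tree theorem `GoodLatticeBDPValueFullDescentStub.stub_fullDescentAtThreeOfRed` (Theorem T′, p658450). READING: once
3a-A's candidate is ruled composed-of-print, the `_OPEN` claim (row A1's analytic PRE input at `p = 3`) is itself a composition of
refereed print with a kernel theorem — no step of the preprint is needed. HONEST FRAMING: conditional bookkeeping; 0 defs, 0 named
facts introduced, 0 sorry; no summit statement / BSD / IMC / Keller–Yin theorem is proved. [cite: KellerYin2024, Thm. 2.2.2
(arXiv:2402.12781v2 TeX L1445–1448)] [cite: CastellaGrossiLeeSkinner2022, Thm. 2.2.1/2.2.2 with (2.16)] [cite: Kriz2016, Rem. 33,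
Thm. 34 (3), Thm. 35] [cite: Ohta2014, Prop. (3.3.3)]
-/

set_option autoImplicit false

-- the route's Theorems namespace repeats the summit name by design (D-0017 nested layout)
set_option linter.dupNamespace false

noncomputable section

open scoped Classical

open WeierstrassCurve NumberField IsDedekindDomain Field Polynomial
  Literature.NumberTheory.EllipticCurves Literature.NumberTheory.EllipticCurves.ModularForms
  Literature.NumberTheory.QuadraticFields Literature.NumberTheory.EllipticCurves.Rank1Residual
  Literature.NumberTheory.EllipticCurves.Castella2018 Literature.NumberTheory.EllipticCurves.GreenbergSelmer
  Literature.NumberTheory.EllipticCurves.GreenbergVatsal2000 Literature.NumberTheory.GaloisRepresentations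
  Literature.NumberTheory.EllipticCurves.CastellaGrossiLeeSkinner2022
  Literature.NumberTheory.EllipticCurves.KellerYin2024

namespace Summit.BirchSwinnertonDyer.BirchSwinnertonDyer.Theorems.GoodLatticeBDPValueAnThreeBookkeeping

/-- An odd prime is `3` or at least `5`. [folklore] -/
theorem eq_three_or_five_le_of_prime_of_two_lt {p : ℕ} (hp : p.Prime) (h2 : 2 < p) : p = 3 ∨ 5 ≤ p := by
  rcases Nat.lt_or_ge p 5 with h | h
  · left
    interval_cases p
    · rfl
    · exact absurd hp (by decide)
  · exact Or.inr h

/-- **KY Thm. 2.2.2 at every odd `p` (`thm222_anacong_goodLattice_OPEN`) from the `5 ≤ p` composed-print fact, the full-descent-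
datum statement (stub 3a-A / Literature candidate) and Theorem T′** (`GoodLatticeBDPValueFullDescentStub.stub_fullDescentAtThreeOfRed`,
unconditional): case `5 ≤ p` by `h5`; case `p = 3` by `hFD` with the datum of T′. Pure bookkeeping.
[cite: KellerYin2024, Thm. 2.2.2 (arXiv:2402.12781v2 TeX L1445–1448)] [cite: Kriz2016, Rem. 33 (first part), Thm. 34 (3), Thm. 35]
[cite: CastellaGrossiLeeSkinner2022, Thm. 2.2.1/2.2.2 with (2.16)] -/
theorem thm222_OPEN_of_fullDescentDatum_of_five_le
    (hFD :
    ∀ (W : WeierstrassCurve ℚ) [W.IsElliptic] [W.IsGloballyMinimal] (p : ℕ) [Fact p.Prime],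
    2 < p → Good W p → Red W p → Anom W p →
    ((∃ (ℓ : ℕ) (hℓ : ℓ.Prime), haveI : Fact ℓ.Prime := ⟨hℓ⟩; Addv W ℓ) ∨
    (∃ (ℓ : ℕ) (hℓ : ℓ.Prime), haveI : Fact ℓ.Prime := ⟨hℓ⟩;
    W.HasMultiplicativeReductionAtPrime ℓ ∧
    ((W.HasSplitMultiplicativeReductionAtPrime ℓ ∧ ℓ ≡ 1 [MOD p]) ∨
    (¬ W.HasSplitMultiplicativeReductionAtPrime ℓ ∧ ℓ + 1 ≡ 0 [MOD p])))) →
    (∀ Φ : AddSubgroup (geomTorsion W (p : ℤ)), IsRationalLine W p Φ → ¬ LineUnramifiedAt W p Φ) →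
    ∀ (K : Type) [Field K] [NumberField K], IsImaginaryQuadratic K →
    SatisfiesHeegnerHypothesis (W.conductorNorm ℤ) K → SatisfiesHeegnerHypothesis p K →
    Odd (NumberField.discr K) → NumberField.discr K ≠ -3 →
    (∀ Q : (W.baseChange K).toAffine.Point, p • Q = 0 → Q = 0) →
    ∀ (ι : K →+* ℚ_[p]) (v vbar : HeightOneSpectrum (𝓞 K)),
    (∀ x : 𝓞 K, x ∈ v.asIdeal ↔ ‖ι (x : K)‖ < 1) →
    ((p : ℕ) : 𝓞 K) ∈ vbar.asIdeal → vbar ≠ v →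
    ∀ (κ : ZpExtension K p), κ.IsAnticyclotomic →
    ∀ (γ : absoluteGaloisGroup K) [Fact (κ.IsTopGenerator γ)],
    ∀ (N : ℕ) [NeZero N] (Dt : ModularParametrizationData W N),
    ∀ (ι' : PadicAlgCl p ≃+* ℂ),
    (∀ (w : InfinitePlace K) (k : 𝓞 K), k ∈ v.asIdeal ↔ ‖ι'.symm (w.embedding (k : K))‖ < 1) →
    ∀ (ΩK : ℂ) (Ωp : (unrIntegers p)ˣ) (L : UnrSeries p), ΩK ≠ 0 →
    IsBDPLFunction ι' v κ γ Dt.f ΩK ((Ωp : unrIntegers p) : ℂ_[p]) L →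
    ∀ (θsub θquot : FramedGaloisRep K (padicCoeffIntegers (∅ : Set (PadicAlgCl p))) 1),
    IsResidualPairOver (W.baseChange K) p θsub θquot →
    ∀ (Sf : Finset (HeightOneSpectrum (𝓞 K))),
    (∀ w : HeightOneSpectrum (𝓞 K), w ∈ Sf ↔ ((W.conductorNorm ℤ : ℤ) : 𝓞 K) ∈ w.asIdeal) →
    ∀ (θK : HeckeCharacter K), IsHeckeCharOf ι' θquot θK →
    ∀ (Cbar : Finset (HeightOneSpectrum (𝓞 K))), (∀ u ∈ Cbar, ¬ θK.IsUnramifiedAt u) →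
    ∀ (ΩK' : ℂ) (Ωp' : (unrIntegers p)ˣ) (Lφ : UnrSeries p), ΩK' ≠ 0 →
    IsKatzLFunction ι' v vbar Cbar κ γ θK ΩK' ((Ωp' : unrIntegers p) : ℂ_[p]) Lφ →
    ∃ n nφ : ℕ, FirstUnitCoeffAt L n ∧ FirstUnitCoeffAt Lφ nφ ∧
    n + ∑ w ∈ Sf, curveLocalLambda κ (W.baseChange K) w =
    2 * nφ + ∑ w ∈ Sf, (charLocalLambda ∅ κ θsub w + charLocalLambda ∅ κ θquot w))
    (h5 : thm222_anacong_goodLattice_of_five_le) : thm222_anacong_goodLattice_OPEN := by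
  intro W _ _ p _ hp hgood hred hanom hlat K _ _ hK hH hHp hodd hd3 htor ι v vbar hv hvbar hne κ hκ γ _
      N _ Dt ι' hι' ΩK Ωp L hΩ hL θsub θquot hpair Sf hSf θK hθK Cbar hC ΩK' Ωp' Lφ hΩ' hLφ
  rcases eq_three_or_five_le_of_prime_of_two_lt (Fact.out : p.Prime) hp with hp3 | hp5
  · exact hFD W p hp hgood hred hanom
      (GoodLatticeBDPValueFullDescentStub.stub_fullDescentAtThreeOfRed W p hp3 hgood hred) hlat K hK hH hHp hodd hd3
      htor ι v vbar hv hvbar hne κ hκ γ N Dt ι' hι' ΩK Ωp L hΩ hL θsub θquot hpair Sf hSf θK hθK Cbar hC ΩK' Ωp' Lφ hΩ' hLφ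
  · exact h5 W p hp5 hgood hred hanom hlat K hK hH hHp hodd hd3 htor ι v vbar hv hvbar hne κ hκ γ N Dt ι' hι' ΩK Ωp L
      hΩ hL θsub θquot hpair Sf hSf θK hθK Cbar hC ΩK' Ωp' Lφ hΩ' hLφ

end Summit.BirchSwinnertonDyer.BirchSwinnertonDyer.Theorems.GoodLatticeBDPValueAnThreeBookkeeping

end
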